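import Summits.AtomisticToContinuum.HydrodynamicLimit.Theorems.LambertianContactSwapSwapGapStubStaticBookkeepingKL
import Summits.AtomisticToContinuum.HydrodynamicLimit.Theorems.LambertianContactSwapSwapGapStubStaticBookkeepingMeans
import Summits.AtomisticToContinuum.HydrodynamicLimit.Theorems.JaynesSqueezeHardSphereLDA
import Summits.AtomisticToContinuum.HydrodynamicLimit.Theorems.JaynesSqueezeLocalGibbsConcentrationDilute
import HarnessLib

/-!
# `SwapGap` (stmt-AtomisticToContinuum-11850), line `Sketch` — stub `stub_staticBookkeeping` (static entropy bookkeeping)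

Support file (`--supports stmt-AtomisticToContinuum-11850`) proving the registered stub `stub_staticBookkeeping` of the
crux `Summit.AtomisticToContinuum.HydrodynamicLimit.Theses.LambertianContactSwap.SwapGap` (skeleton
`Cruxes/SwapGap/Lines/Sketch.lean`, v3): the Λ-free, Φ-free STATIC half of the Λ-adiabaticity step S1a. With
`P_N = localGibbsLaw σ a₀ u₀ θ₀ N (Φ N)` the local Gibbs data and `G_N = localGibbsLaw σ 1 0 1 N (Φ N)` the standard
homogeneous Gibbs law: for EVERY family of probability laws `μ_N` with (i) `KL(μ_N ‖ G_N) ≤ KL(P_N ‖ G_N)`, (ii) the same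
law of the kinetic energy as `P_N`, (iii) empirical density / momentum / energy fields converging in `μ_N`-probability to
the values of the classical hs-Euler solution at time `t` (dilute window), `[KL(P_N ‖ G_N) − KL(μ_N ‖ G_N)]/(N+1) → 0`.

PROOF (Yau's bookkeeping at the Euler-matched reference, no dynamics):
1. Thresholds `η₀ = min(η₁^{LDA}, η₂^{conc}, η^{EOS})`, `σ₀ = min(1/2, η_A/Λ², η₂/(2Λ²))` (`Λ⁻¹ ≤ a₀ ≤ Λ`).
2. `a₀ = e^c ρ^{st} e^{g_σ(ρ^{st})}` (`activity_inversion_continuous`); the constant drops out of the canonical law, and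
   the static exponential concentration of the matched law (`localGibbsConcentrationDilute_proof`) together
   with the `t = 0` tie identify `(ρ^{st}, u₀, θ₀) = (ρ, u, θ)(0)` (`profiles_eq_of_tendsto`).
3. The entropy gap against the matched law `ψ_N` of `(ρ_t, u_t, θ_t)` (file `…StubStaticBookkeepingKL`,
   `toReal_klDiv_sub_le`; hypothesis (ii) cancels the `G`-terms):
   `0 ≤ [KL(P‖G) − KL(μ‖G)]/(N+1) ≤ E_P⟨emp, Λ₀⟩ − (N+1)⁻¹ log Z₀ − E_μ⟨emp, Λ_t⟩ + (N+1)⁻¹ log Z_t`.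
4. `(N+1)⁻¹ log Z_s → π_s` (`hardSphereLDA_proof` (B1)); `E_P⟨emp, Λ₀⟩ → m₀` and `E_μ⟨emp, Λ_t⟩ → m_t` by the flow-free means
   machinery (file `…StubStaticBookkeepingMeans`: bounded second velocity moments and the total kinetic energy in mean —
   under `μ_N` both come from `P_N` through (ii), the latter `→ ∫E₀ = ∫E_t` by `tendsto_integral_kineticEnergy` and energy
   conservation `integral_totalEnergyDensity_eq`).
5. `m₀ − π₀ = m_t − π_t`: mass conservation + isentropy of classical solutions in the analytic band of the equation of
   state (`integral_entropy_eq_of_band_Icc`); conclude with `tendsto_zero_of_bookkeeping`.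
References: H.-T. Yau, Lett. Math. Phys. 22 (1991) §2; C. Kipnis – C. Landim (1999), Ch. 6 §1; H. Spohn (1991) §2.3.
-/

noncomputable section

open MeasureTheory Filter Set Topology InformationTheory
open scoped ENNReal

namespace Summit.AtomisticToContinuum.HydrodynamicLimit.Theorems.SwapGapStaticBookkeeping

open Literature.Analysis.FluidPDE Literature.MathematicalPhysics.KineticTheory Literature.Analysis.FunctionSpaces
open Summit.AtomisticToContinuum.HydrodynamicLimit.Theorems.NearConstantShortTimeHL

/-- **STATIC ENTROPY BOOKKEEPING** (registered stub `stub_staticBookkeeping` of crux stmt-AtomisticToContinuum-11850,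
line `Sketch`): for continuous profiles there are a dilute window `η₀ > 0` and `σ₀ > 0` such that for `0 < σ < σ₀`,
every classical hs-Euler solution with packing `< η₀`, every flow family and local Gibbs data tied at `t = 0`, every
`t ∈ [0, T)` and every family of probability laws `μ_N` with no less entropy than the data relative to the homogeneous
Gibbs law, the same kinetic-energy law, and empirical fields converging to the Euler values at time `t`:
`[KL(P_N ‖ G_N) − KL(μ_N ‖ G_N)]/(N+1) → 0`. See the module docstring for the proof. [cite: Yau1991, §2] -/
theorem stub_staticBookkeeping :
    ∀ (a₀ θ₀ : T3 → ℝ) (u₀ : T3 → V3), Continuous a₀ → Continuous θ₀ → Continuous u₀ →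
      (∀ x, 0 < a₀ x) → (∀ x, 0 < θ₀ x) →
      ∃ η₀ : ℝ, 0 < η₀ ∧ ∃ σ₀ : ℝ, 0 < σ₀ ∧ ∀ σ : ℝ, 0 < σ → σ < σ₀ →
        ∀ (T : ℝ) (ρ θ : ℝ → T3 → ℝ) (u : ℝ → T3 → V3), IsHardSphereEulerSolution σ T ρ u θ →
          (∀ t ∈ Set.Ico 0 T, ∀ x, ρ t x * σ ^ 3 < η₀) →
          ∀ Φ : (N : ℕ) → HardSphereFlow (Torus.geometry (Fin 3)) (hsDiameter σ N) (N + 1),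
            TendstoHydroFieldsAt (fun N => localGibbsLaw σ a₀ u₀ θ₀ N (Φ N)) Φ ρ u θ 0 →
              ∀ t ∈ Set.Ico 0 T, ∀ μ : (N : ℕ) → Measure (Config (N + 1) (Fin 3) T3),
                (∀ N, IsProbabilityMeasure (μ N)) →
                (∀ N, klDiv (μ N) (localGibbsLaw σ (fun _ => 1) (fun _ => 0) (fun _ => 1) N (Φ N)) ≤
                  klDiv (localGibbsLaw σ a₀ u₀ θ₀ N (Φ N))
                    (localGibbsLaw σ (fun _ => 1) (fun _ => 0) (fun _ => 1) N (Φ N))) →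
                (∀ N, (μ N).map configEnergy = (localGibbsLaw σ a₀ u₀ θ₀ N (Φ N)).map configEnergy) →
                (∀ χ : T3 → ℝ, Continuous χ → ∀ δ : ℝ, 0 < δ →
                  Tendsto (fun N => μ N {z | δ < |empiricalDensityField z χ - ∫ x, χ x * ρ t x|})
                    atTop (𝓝 0) ∧
                  Tendsto (fun N => μ N {z | δ < ‖empiricalMomentumField z χ -
                    ∫ x, (χ x * ρ t x) • u t x‖}) atTop (𝓝 0) ∧
                  Tendsto (fun N => μ N {z | δ < |empiricalEnergyField z χ -
                    ∫ x, χ x * totalEnergyDensity (ρ t x) (u t x) (θ t x)|}) atTop (𝓝 0)) →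
                Tendsto (fun N : ℕ =>
                  ((klDiv (localGibbsLaw σ a₀ u₀ θ₀ N (Φ N))
                      (localGibbsLaw σ (fun _ => 1) (fun _ => 0) (fun _ => 1) N (Φ N))).toReal -
                    (klDiv (μ N) (localGibbsLaw σ (fun _ => 1) (fun _ => 0) (fun _ => 1) N (Φ N))).toReal) /
                  ((N : ℝ) + 1)) atTop (𝓝 0) := by
  intro a₀ θ₀ u₀ ha hθ hu ha0 hθ0
  ------------------------------------------------------------------
  -- Step 0: the equation of state, the static packages, the thresholds
  ------------------------------------------------------------------
  obtain ⟨ηE, hηE, F, hFa, hEqF, hF0, -, -⟩ := hsEosLowDensity_proof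
  obtain ⟨η₁, hη₁, H1⟩ := hardSphereLDA_proof Theses.JaynesSqueeze.HsEosLowDensity_holds
  obtain ⟨η₂, hη₂, H2⟩ := localGibbsConcentrationDilute_proof Theses.JaynesSqueeze.HsEosLowDensity_holds
  obtain ⟨ηA, hηA, hinvA⟩ := activity_inversion_continuous hηE hFa hEqF hF0
  have hfex : ContDiffOn ℝ ((⊤ : ℕ∞) : WithTop ℕ∞) hsExcessFreeEnergy (Ioo 0 ηE) :=
    (hFa.contDiffOn_of_completeSpace.mono (Ioo_subset_Ioo (by linarith) le_rfl)).congr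
      fun r hr => hEqF ⟨hr.1.le, hr.2⟩
  set η₀ : ℝ := min (min η₁ η₂) ηE with hη₀def
  have hη₀ : 0 < η₀ := lt_min (lt_min hη₁ hη₂) hηE
  have hη₀₁ : η₀ ≤ η₁ := (min_le_left _ _).trans (min_le_left _ _)
  have hη₀E : η₀ ≤ ηE := min_le_right _ _
  refine ⟨η₀, hη₀, ?_⟩
  -- bounds on the activity profile
  obtain ⟨Aup, -, hAup⟩ := exists_forall_abs_le_of_continuous ha
  obtain ⟨x₀, -, hx₀⟩ := isCompact_univ.exists_isMinOn univ_nonempty ha.continuousOn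
  have hamin : ∀ x, a₀ x₀ ≤ a₀ x := fun x => hx₀ (mem_univ x)
  set Λ : ℝ := max (max Aup (a₀ x₀)⁻¹) 1 with hΛdef
  have hΛ1 : 1 ≤ Λ := le_max_right _ _
  have hΛ0 : 0 < Λ := one_pos.trans_le hΛ1
  have haΛ : ∀ x, Λ⁻¹ ≤ a₀ x ∧ a₀ x ≤ Λ := fun x =>
    ⟨calc Λ⁻¹ ≤ ((a₀ x₀)⁻¹)⁻¹ := inv_anti₀ (inv_pos.2 (ha0 x₀)) ((le_max_right _ _).trans (le_max_left _ _))
        _ = a₀ x₀ := inv_inv _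
        _ ≤ a₀ x := hamin x,
      ((le_abs_self _).trans (hAup x)).trans ((le_max_left _ _).trans (le_max_left _ _))⟩
  set σA : ℝ := min (1 / 2) (min (ηA / Λ ^ 2) (η₂ / (2 * Λ ^ 2))) with hσAdef
  have hσA : 0 < σA := lt_min (by norm_num) (lt_min (by positivity) (by positivity))
  refine ⟨σA, hσA, ?_⟩
  intro σ hσ hσlt T ρ θ u hE hpack Φ h0 t ht μ hμ hKL hEn hLLN
  have hσ2 : σ ≤ 1 / 2 := (hσlt.trans_le (min_le_left _ _)).le
  have hσ3 : 0 < σ ^ 3 := pow_pos hσ 3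
  have hσ31 : σ ^ 3 ≤ σ := by
    calc σ ^ 3 = σ * (σ * σ) := by ring
      _ ≤ σ * 1 := by gcongr; nlinarith [hσ2.trans (by norm_num : (1 / 2 : ℝ) ≤ 1)]
      _ = σ := mul_one σ
  have hpackA : Λ ^ 2 * σ ^ 3 ≤ ηA := by
    have h1 : σ ≤ ηA / Λ ^ 2 := (hσlt.trans_le ((min_le_right _ _).trans (min_le_left _ _))).le
    rw [le_div_iff₀ (by positivity)] at h1
    nlinarith
  have hband2 : 2 * Λ ^ 2 * σ ^ 3 ≤ η₂ := by
    have h1 : σ ≤ η₂ / (2 * Λ ^ 2) := (hσlt.trans_le ((min_le_right _ _).trans (min_le_right _ _))).le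
    rw [le_div_iff₀ (by positivity)] at h1
    nlinarith
  have htT : t < T := ht.2
  have h0I : (0 : ℝ) ∈ Ico 0 T := ⟨le_rfl, ht.1.trans_lt htT⟩
  have h0t : (0 : ℝ) ∈ Icc 0 t := ⟨le_rfl, ht.1⟩
  have htt : t ∈ Icc 0 t := ⟨ht.1, le_rfl⟩
  have hg : ∀ s ∈ Icc 0 t, ∀ x, ρ s x * σ ^ 3 < η₀ := fun s hs x => hpack s ⟨hs.1, hs.2.trans_lt htT⟩ x
  haveI hμI : ∀ N, IsProbabilityMeasure (μ N) := hμ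
  have hn_top : Tendsto (fun N : ℕ => N + 1) atTop atTop := tendsto_add_atTop_nat 1
  set g : ℝ → ℝ := fun r => hsExcessFreeEnergy (r * σ ^ 3) + r * σ ^ 3 * deriv hsExcessFreeEnergy (r * σ ^ 3)
    with hgdef
  ------------------------------------------------------------------
  -- Step 1: inversion of the activity; the constant drops out of the canonical law
  ------------------------------------------------------------------
  obtain ⟨ρst, hρstc, hρstb, hρst1, c, hc⟩ := hinvA σ hσ Λ hΛ1 hpackA a₀ ha haΛ
  have hρst0 : ∀ x, 0 < ρst x := fun x => (by positivity : (0 : ℝ) < (2 * Λ ^ 2)⁻¹).trans_le (hρstb x).1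
  have ha₀eq : a₀ = fun x => Real.exp c * (ρst x * Real.exp (g (ρst x))) := by
    funext x; rw [hc x]; ring
  subst ha₀eq
  have hpc : Continuous fun x => ρst x * Real.exp (g (ρst x)) := by
    have h : (fun x => ρst x * Real.exp (g (ρst x))) =
        fun x => Real.exp (-c) * (Real.exp c * (ρst x * Real.exp (g (ρst x)))) := by
      funext x; rw [← mul_assoc, ← Real.exp_add]; simp
    rw [h]; exact continuous_const.mul ha
  have hp0 : ∀ x, 0 < ρst x * Real.exp (g (ρst x)) := fun x => mul_pos (hρst0 x) (Real.exp_pos _)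
  have hPeq : ∀ N, localGibbsLaw σ (fun x => Real.exp c * (ρst x * Real.exp (g (ρst x)))) u₀ θ₀ N (Φ N) =
      localGibbsLaw σ (fun x => ρst x * Real.exp (g (ρst x))) u₀ θ₀ N (Φ N) := by
    intro N
    unfold localGibbsLaw
    rw [MacroClosureLine.StubLedger.localGibbsProfile_const_mul]
    congr 1
    funext z
    exact KineticWindowGronwallNegative.canonicalDensity_const_mul (Real.exp_pos c).ne' _ _ z
  simp only [hPeq] at hKL hEn ⊢
  have hP : ∀ N, IsProbabilityMeasure (localGibbsLaw σ (fun x => ρst x * Real.exp (g (ρst x))) u₀ θ₀ N (Φ N)) :=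
    fun N => isProbabilityMeasure_localGibbsLaw hpc hθ hu hp0 hθ0 hσ2 N (Φ N)
  have hPac : ∀ N, localGibbsLaw σ (fun x => ρst x * Real.exp (g (ρst x))) u₀ θ₀ N (Φ N) ≪
      liouville (Torus.geometry (Fin 3)) (N + 1) (hsDiameter σ N) := fun N =>
    particleLaw_absolutelyContinuous (Φ N) _
  -- the `t = 0` tie, under the matched law and flow-free
  have h₂ : ∀ χ : T3 → ℝ, Continuous χ → ∀ δ : ℝ, 0 < δ →
      Tendsto (fun N => localGibbsLaw σ (fun x => ρst x * Real.exp (g (ρst x))) u₀ θ₀ N (Φ N)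
        {z | δ < |empiricalDensityField z χ - ∫ x, χ x * ρ 0 x|}) atTop (𝓝 0) ∧
      Tendsto (fun N => localGibbsLaw σ (fun x => ρst x * Real.exp (g (ρst x))) u₀ θ₀ N (Φ N)
        {z | δ < ‖empiricalMomentumField z χ - ∫ x, (χ x * ρ 0 x) • u 0 x‖}) atTop (𝓝 0) ∧
      Tendsto (fun N => localGibbsLaw σ (fun x => ρst x * Real.exp (g (ρst x))) u₀ θ₀ N (Φ N)
        {z | δ < |empiricalEnergyField z χ -
          ∫ x, χ x * totalEnergyDensity (ρ 0 x) (u 0 x) (θ 0 x)|}) atTop (𝓝 0) := by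
    intro χ hχ δ hδ
    obtain ⟨h1, h2, h3⟩ := h0 χ hχ δ hδ
    simp only [hPeq] at h1 h2 h3
    refine ⟨h1.congr fun N => ?_, h2.congr fun N => ?_, h3.congr fun N => ?_⟩
    · exact measure_setOf_flow_zero_mem (Φ N) (hPac N) {z | δ < |empiricalDensityField z χ - ∫ x, χ x * ρ 0 x|}
    · exact measure_setOf_flow_zero_mem (Φ N) (hPac N)
        {z | δ < ‖empiricalMomentumField z χ - ∫ x, (χ x * ρ 0 x) • u 0 x‖}
    · exact measure_setOf_flow_zero_mem (Φ N) (hPac N)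
        {z | δ < |empiricalEnergyField z χ - ∫ x, χ x * totalEnergyDensity (ρ 0 x) (u 0 x) (θ 0 x)|}
  clear h0
  ------------------------------------------------------------------
  -- Step 2: identification of the Euler data at `t = 0`
  ------------------------------------------------------------------
  have hS2₀ := H2 σ hσ (2 * Λ ^ 2)⁻¹ (by positivity) ρst hρstc
    (fun x => ⟨(hρstb x).1, (mul_le_mul_of_nonneg_right (hρstb x).2 hσ3.le).trans (by linarith [hband2])⟩)
    hρst1 u₀ θ₀ hu hθ hθ0
  have h₁ : ∀ χ : T3 → ℝ, Continuous χ → ∀ δ : ℝ, 0 < δ →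
      Tendsto (fun N => localGibbsLaw σ (fun x => ρst x * Real.exp (g (ρst x))) u₀ θ₀ N (Φ N)
        {z | δ < |empiricalDensityField z χ - ∫ x, χ x * ρst x|}) atTop (𝓝 0) ∧
      Tendsto (fun N => localGibbsLaw σ (fun x => ρst x * Real.exp (g (ρst x))) u₀ θ₀ N (Φ N)
        {z | δ < ‖empiricalMomentumField z χ - ∫ x, (χ x * ρst x) • u₀ x‖}) atTop (𝓝 0) ∧
      Tendsto (fun N => localGibbsLaw σ (fun x => ρst x * Real.exp (g (ρst x))) u₀ θ₀ N (Φ N)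
        {z | δ < |empiricalEnergyField z χ -
          ∫ x, χ x * totalEnergyDensity (ρst x) (u₀ x) (θ₀ x)|}) atTop (𝓝 0) := by
    intro χ hχ δ hδ
    obtain ⟨C, hC, hCN⟩ := hS2₀ χ hχ δ hδ
    refine ⟨tendsto_zero_of_le_exp hn_top hC fun N => ?_, tendsto_zero_of_le_exp hn_top hC fun N => ?_,
      tendsto_zero_of_le_exp hn_top hC fun N => ?_⟩
    · rw [Nat.cast_succ]; exact (hCN N (Φ N)).1
    · rw [Nat.cast_succ]; exact (hCN N (Φ N)).2.1
    · rw [Nat.cast_succ]; exact (hCN N (Φ N)).2.2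
  obtain ⟨hρst, hu₀, hθ₀⟩ := profiles_eq_of_tendsto
    (P := fun N => localGibbsLaw σ (fun x => ρst x * Real.exp (g (ρst x))) u₀ θ₀ N (Φ N)) hP
    (fun N z χ => empiricalDensityField z χ) (fun N z χ => empiricalMomentumField z χ)
    (fun N z χ => empiricalEnergyField z χ) hρstc hθ hu
    (hE.smooth_density.isSmooth_slice h0I).continuous (hE.smooth_temperature.isSmooth_slice h0I).continuous
    (hE.smooth_velocity.isSmooth_slice h0I).continuous hρst0 h₁ h₂
  subst hρst hu₀ hθ₀
  clear h₁ hS2₀ H2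
  ------------------------------------------------------------------
  -- Step 3: the data at time `t`; the free energies at `0` and at `t`
  ------------------------------------------------------------------
  have hρtc : Continuous (ρ t) := (hE.smooth_density.isSmooth_slice ht).continuous
  have hθtc : Continuous (θ t) := (hE.smooth_temperature.isSmooth_slice ht).continuous
  have hutc : Continuous (u t) := (hE.smooth_velocity.isSmooth_slice ht).continuous
  have hρt0 : ∀ x, 0 < ρ t x := hE.density_pos t ht
  have hθt0 : ∀ x, 0 < θ t x := hE.temperature_pos t ht
  have hρ00 : ∀ x, 0 < ρ 0 x := hE.density_pos 0 h0I
  have hθ00 : ∀ x, 0 < θ 0 x := hE.temperature_pos 0 h0I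
  obtain ⟨xt, -, hxt⟩ := isCompact_univ.exists_isMinOn univ_nonempty hρtc.continuousOn
  have hmass : ∫ x, ρ t x = 1 := (DenseExcursionEverywhere.integral_density_eq hE ht).trans hρst1
  have hbandt : ∀ x, ρ t xt ≤ ρ t x ∧ ρ t x * σ ^ 3 ≤ η₁ := fun x =>
    ⟨hxt (mem_univ x), ((hg t htt x).le).trans hη₀₁⟩
  obtain ⟨x0m, -, hx0m⟩ := isCompact_univ.exists_isMinOn univ_nonempty hρstc.continuousOn
  have hband0 : ∀ x, ρ 0 x0m ≤ ρ 0 x ∧ ρ 0 x * σ ^ 3 ≤ η₁ := fun x =>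
    ⟨hx0m (mem_univ x), ((hg 0 h0t x).le).trans hη₀₁⟩
  obtain ⟨hπ₀, -, -⟩ := (H1 σ hσ).2 (ρ 0 x0m) (hρ00 x0m) (ρ 0) hρstc.measurable hband0 hρst1 (u 0) (θ 0)
    hu.measurable hθ.measurable hθ0 Φ
  obtain ⟨hπt, -, -⟩ := (H1 σ hσ).2 (ρ t xt) (hρt0 xt) (ρ t) hρtc.measurable hbandt hmass (u t) (θ t)
    hutc.measurable hθtc.measurable hθt0 Φ
  clear H1
  -- the matched profiles at `t`
  have hbsE : ∀ s ∈ Icc 0 t, ∀ x, ρ s x * σ ^ 3 ∈ Ioo 0 ηE := fun s hs x =>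
    ⟨mul_pos (hE.density_pos s ⟨hs.1, hs.2.trans_lt htT⟩ x) hσ3, (hg s hs x).trans_le hη₀E⟩
  have hgc : ∀ s ∈ Icc 0 t, Continuous fun x => g (ρ s x) := by
    intro s hs
    have hsT : s ∈ Ico 0 T := ⟨hs.1, hs.2.trans_lt htT⟩
    have hηc : Continuous fun x => ρ s x * σ ^ 3 := (hE.smooth_density.isSmooth_slice hsT).continuous.mul continuous_const
    exact ((hfex.continuousOn.comp_continuous hηc (hbsE s hs)).add (hηc.mul
      ((hfex.continuousOn_deriv_of_isOpen isOpen_Ioo (by simp)).comp_continuous hηc (hbsE s hs))))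
  have hqc : Continuous fun x => ρ t x * Real.exp (g (ρ t x)) := hρtc.mul (hgc t htt).rexp
  have hq0 : ∀ x, 0 < ρ t x * Real.exp (g (ρ t x)) := fun x => mul_pos (hρt0 x) (Real.exp_pos _)
  have hAc : ∀ s ∈ Icc 0 t, Continuous fun x => Real.log (ρ s x) + g (ρ s x) - 3 / 2 * Real.log (2 * Real.pi * θ s x) := by
    intro s hs
    have hsT : s ∈ Ico 0 T := ⟨hs.1, hs.2.trans_lt htT⟩
    have hρc := (hE.smooth_density.isSmooth_slice hsT).continuous
    have hθc := (hE.smooth_temperature.isSmooth_slice hsT).continuous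
    have hρp := hE.density_pos s hsT
    have hθp := hE.temperature_pos s hsT
    exact ((hρc.log fun x => (hρp x).ne').add (hgc s hs)).sub
      (continuous_const.mul ((continuous_const.mul hθc).log fun x =>
        (mul_pos (mul_pos two_pos Real.pi_pos) (hθp x)).ne'))
  ------------------------------------------------------------------
  -- Step 4: the bookkeeping identity `m₀ − π₀ = m_t − π_t` (mass conservation + isentropy)
  ------------------------------------------------------------------
  have hEnt := integral_entropy_eq_of_band_Icc hσ hfex hE ht (fun s hs x => (hg s hs x).trans_le hη₀E)
  have hMass := DenseExcursionEverywhere.integral_density_eq hE ht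
  have hsplit : ∀ s ∈ Icc 0 t,
      (∫ x, ρ s x * (Real.log (ρ s x) + g (ρ s x) - 3 / 2 * Real.log (2 * Real.pi * θ s x) - 3 / 2)) -
        ∫ x, ρ s x * (ρ s x * σ ^ 3 * deriv hsExcessFreeEnergy (ρ s x * σ ^ 3)) =
      -(∫ x, ρ s x * (3 / 2 * Real.log (θ s x) - Real.log (ρ s x) - hsExcessFreeEnergy (ρ s x * σ ^ 3))) -
        (3 / 2 * Real.log (2 * Real.pi) + 3 / 2) * ∫ x, ρ s x := fun s hs =>
    integral_logProfile_sub_pressure_eq hfex g (fun r => rfl)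
      (hE.smooth_density.isSmooth_slice ⟨hs.1, hs.2.trans_lt htT⟩).continuous
      (hE.smooth_temperature.isSmooth_slice ⟨hs.1, hs.2.trans_lt htT⟩).continuous
      (hE.density_pos s ⟨hs.1, hs.2.trans_lt htT⟩) (hE.temperature_pos s ⟨hs.1, hs.2.trans_lt htT⟩) (hbsE s hs)
  have hid : (∫ x, ρ 0 x * (Real.log (ρ 0 x) + g (ρ 0 x) - 3 / 2 * Real.log (2 * Real.pi * θ 0 x) - 3 / 2)) -
        (∫ x, ρ 0 x * (ρ 0 x * σ ^ 3 * deriv hsExcessFreeEnergy (ρ 0 x * σ ^ 3))) =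
      (∫ x, ρ t x * (Real.log (ρ t x) + g (ρ t x) - 3 / 2 * Real.log (2 * Real.pi * θ t x) - 3 / 2)) -
        ∫ x, ρ t x * (ρ t x * σ ^ 3 * deriv hsExcessFreeEnergy (ρ t x * σ ^ 3)) := by
    rw [hsplit 0 h0t, hsplit t htt, hEnt, hMass]
  ------------------------------------------------------------------
  -- Step 5: the means under `P_N` (time `0`) and under `μ_N` (time `t`)
  ------------------------------------------------------------------
  set P : (N : ℕ) → Measure (Config (N + 1) (Fin 3) T3) := fun N =>
    localGibbsLaw σ (fun x => ρ 0 x * Real.exp (g (ρ 0 x))) (u 0) (θ 0) N (Φ N) with hPdef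
  haveI hPI : ∀ N, IsProbabilityMeasure (P N) := hP
  haveI hPI' : ∀ N, IsProbabilityMeasure (particleLaw (Φ N) (canonicalDensity (Torus.geometry (Fin 3))
    (hsDiameter σ N) (N + 1) (localGibbsProfile (fun x => ρ 0 x * Real.exp (g (ρ 0 x))) (u 0) (θ 0)))) := hP
  -- a uniform bound on the mean squared speed
  obtain ⟨Θ, -, hΘ⟩ := exists_forall_abs_le_of_continuous hθ
  obtain ⟨U, -, hU⟩ := exists_forall_abs_le_of_continuous (continuous_norm.comp hu)
  set B₁ : ℝ := 3 * Θ + U ^ 2 with hB₁def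
  have hB₁ : ∀ x, 3 * θ 0 x + ‖u 0 x‖ ^ 2 ≤ B₁ := fun x => by
    have h1 : θ 0 x ≤ Θ := (le_abs_self _).trans (hΘ x)
    have h2 : ‖u 0 x‖ ^ 2 ≤ U ^ 2 := pow_le_pow_left₀ (norm_nonneg _) ((le_abs_self _).trans (hU x)) 2
    rw [hB₁def]
    linarith
  have hVP : ∀ N, ∫⁻ z, ENNReal.ofReal (((N + 1 : ℕ) : ℝ)⁻¹ * ∑ i, ‖(z i).2‖ ^ 2) ∂P N ≤ ENNReal.ofReal B₁ :=
    fun N => lintegral_avg_norm_sq_vel_le (Φ N) hpc hθ hu (fun x => (hp0 x).le) hθ0 hB₁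
  have hVμ : ∀ N, ∫⁻ z, ENNReal.ofReal (((N + 1 : ℕ) : ℝ)⁻¹ * ∑ i, ‖(z i).2‖ ^ 2) ∂μ N ≤ ENNReal.ofReal B₁ := by
    intro N
    have hfun : ∀ z : Config (N + 1) (Fin 3) T3, ((N + 1 : ℕ) : ℝ)⁻¹ * ∑ i, ‖(z i).2‖ ^ 2 =
        (2 * ((N + 1 : ℕ) : ℝ)⁻¹) * configEnergy z := fun z => by
      rw [show configEnergy z = 2⁻¹ * ∑ i, ‖(z i).2‖ ^ 2 from rfl]; ring
    have hF : Measurable fun e : ℝ => ENNReal.ofReal ((2 * ((N + 1 : ℕ) : ℝ)⁻¹) * e) :=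
      (measurable_const.mul measurable_id).ennreal_ofReal
    calc ∫⁻ z, ENNReal.ofReal (((N + 1 : ℕ) : ℝ)⁻¹ * ∑ i, ‖(z i).2‖ ^ 2) ∂μ N
        = ∫⁻ z, ENNReal.ofReal ((2 * ((N + 1 : ℕ) : ℝ)⁻¹) * configEnergy z) ∂μ N :=
          lintegral_congr fun z => by rw [hfun]
      _ = ∫⁻ z, ENNReal.ofReal ((2 * ((N + 1 : ℕ) : ℝ)⁻¹) * configEnergy z) ∂P N :=
          lintegral_comp_eq_of_map_eq Alexander.measurable_configEnergy (hEn N) hF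
      _ = ∫⁻ z, ENNReal.ofReal (((N + 1 : ℕ) : ℝ)⁻¹ * ∑ i, ‖(z i).2‖ ^ 2) ∂P N :=
          lintegral_congr fun z => by rw [hfun]
      _ ≤ ENNReal.ofReal B₁ := hVP N
  -- the total kinetic energy in mean: `P`-side by statics, `μ`-side through the energy law
  set IE : ℝ := ∫ x, (fun _ => (1 : ℝ)) x * totalEnergyDensity (ρ 0 x) (u 0 x) (θ 0 x) with hIEdef
  have hKP0 : Tendsto (fun N => ∫ z, empiricalEnergyField ((Φ N).flow 0 z) (fun _ => (1 : ℝ)) ∂P N) atTop (𝓝 IE) :=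
    tendsto_integral_kineticEnergy hpc hθ hu hp0 hθ0 Φ hn_top hP
      (fun δ hδ => by
        have h := (h₂ (fun _ => (1 : ℝ)) continuous_const δ hδ).2.2
        refine h.congr fun N => ?_
        exact (measure_setOf_flow_zero_mem (Φ N) (hPac N)
          {z | δ < |empiricalEnergyField z (fun _ => (1 : ℝ)) - IE|}).symm) 0
  have hKP : Tendsto (fun N => ∫ z, empiricalEnergyField z (fun _ => (1 : ℝ)) ∂P N) atTop (𝓝 IE) := by
    refine hKP0.congr fun N => integral_congr_ae ?_
    filter_upwards [sum_norm_sq_vel_flow_ae (Φ N) (hPac N) 0] with z hz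
    rw [empiricalEnergyField_one_eq_avg, empiricalEnergyField_one_eq_avg]
    congr 1
    rw [← Finset.sum_div, ← Finset.sum_div]
    exact congrArg (· / (2 : ℝ)) hz
  have hIE : IE = ∫ x, totalEnergyDensity (ρ 0 x) (u 0 x) (θ 0 x) := by
    rw [hIEdef]; simp
  have hMCP := tendsto_means_of_fields P hP hρstc hθ hu hVP (by rw [← hIE]; exact hKP) h₂
  have hfun1 : ∀ (N : ℕ) (z : Config (N + 1) (Fin 3) T3), empiricalEnergyField z (fun _ => (1 : ℝ)) =
      ((N + 1 : ℕ) : ℝ)⁻¹ * configEnergy z := fun N z => by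
    rw [empiricalEnergyField_one_eq_avg, show configEnergy z = 2⁻¹ * ∑ i, ‖(z i).2‖ ^ 2 from rfl, Finset.mul_sum,
      Finset.mul_sum, Finset.mul_sum]
    exact Finset.sum_congr rfl fun i _ => by ring
  have hKμ : Tendsto (fun N => ∫ z, empiricalEnergyField z (fun _ => (1 : ℝ)) ∂μ N) atTop
      (𝓝 (∫ x, totalEnergyDensity (ρ t x) (u t x) (θ t x))) := by
    rw [integral_totalEnergyDensity_eq hFa hEqF hσ hE ht (fun s hs x => (hg s hs x).trans_le hη₀E), ← hIE]
    refine hKP.congr fun N => ?_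
    have hiP : Integrable (fun z => ((N + 1 : ℕ) : ℝ)⁻¹ * configEnergy z) (P N) :=
      (((hMCP (fun _ => (1 : ℝ)) continuous_const).1 N).2.2).congr (Eventually.of_forall (hfun1 N))
    obtain ⟨-, h⟩ := integral_comp_eq_of_map_eq Alexander.measurable_configEnergy (hEn N)
      (continuous_const.mul continuous_id) (F := fun e => ((N + 1 : ℕ) : ℝ)⁻¹ * e) hiP
    simp_rw [hfun1]
    exact h.symm
  have hMCμ := tendsto_means_of_fields μ hμ hρtc hθtc hutc hVμ hKμ hLLN
  -- the means of the two log-profiles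
  obtain ⟨hIP, hxT⟩ := tendsto_logProfileMean P hρstc hθ (hAc 0 h0t) hu (fun x => (hθ00 x).ne') hMCP
  obtain ⟨hIμ, hyT⟩ := tendsto_logProfileMean μ hρtc hθtc (hAc t htt) hutc (fun x => (hθt0 x).ne') hMCμ
  have hmean0 : ∀ (N : ℕ) (z : Config (N + 1) (Fin 3) T3),
      ∫ y, Real.log (localGibbsProfile (fun x => ρ 0 x * Real.exp (g (ρ 0 x))) (u 0) (θ 0) y) ∂(empiricalMeasure z) =
      ∫ y, ((fun x => Real.log (ρ 0 x) + g (ρ 0 x) - 3 / 2 * Real.log (2 * Real.pi * θ 0 x)) y.1 -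
        ‖y.2 - u 0 y.1‖ ^ 2 / (2 * θ 0 y.1)) ∂(empiricalMeasure z) := fun N z =>
    integral_congr_ae (Eventually.of_forall fun y => log_localGibbsProfile_matched g hρ00 hθ00 y)
  have hmeant : ∀ (N : ℕ) (z : Config (N + 1) (Fin 3) T3),
      ∫ y, Real.log (localGibbsProfile (fun x => ρ t x * Real.exp (g (ρ t x))) (u t) (θ t) y) ∂(empiricalMeasure z) =
      ∫ y, ((fun x => Real.log (ρ t x) + g (ρ t x) - 3 / 2 * Real.log (2 * Real.pi * θ t x)) y.1 -
        ‖y.2 - u t y.1‖ ^ 2 / (2 * θ t y.1)) ∂(empiricalMeasure z) := fun N z =>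
    integral_congr_ae (Eventually.of_forall fun y => log_localGibbsProfile_matched g hρt0 hθt0 y)
  ------------------------------------------------------------------
  -- Step 6: the entropy gap, and the conclusion
  ------------------------------------------------------------------
  set x : ℕ → ℝ := fun N => ∫ z, (∫ y, Real.log (localGibbsProfile (fun x => ρ 0 x * Real.exp (g (ρ 0 x))) (u 0) (θ 0) y)
    ∂(empiricalMeasure z)) ∂P N with hxdef
  set y : ℕ → ℝ := fun N => ∫ z, (∫ y, Real.log (localGibbsProfile (fun x => ρ t x * Real.exp (g (ρ t x))) (u t) (θ t) y)
    ∂(empiricalMeasure z)) ∂μ N with hydef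
  set Z0 : ℕ → ℝ := fun N => canonicalPartition (Torus.geometry (Fin 3)) (hsDiameter σ N) (N + 1)
    (localGibbsProfile (fun x => ρ 0 x * Real.exp (g (ρ 0 x))) (u 0) (θ 0)) with hZ0
  set Zt : ℕ → ℝ := fun N => canonicalPartition (Torus.geometry (Fin 3)) (hsDiameter σ N) (N + 1)
    (localGibbsProfile (fun x => ρ t x * Real.exp (g (ρ t x))) (u t) (θ t)) with hZt
  set K : ℕ → ℝ := fun N =>
    (klDiv (P N) (localGibbsLaw σ (fun _ => 1) (fun _ => 0) (fun _ => 1) N (Φ N))).toReal -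
      (klDiv (μ N) (localGibbsLaw σ (fun _ => 1) (fun _ => 0) (fun _ => 1) N (Φ N))).toReal with hKdef
  have hest : ∀ N, 0 ≤ K N ∧ K N ≤ ((N : ℝ) + 1) * (x N - y N) - Real.log (Z0 N) + Real.log (Zt N) := fun N =>
    toReal_klDiv_sub_le hpc hθ hu hp0 hθ0 hqc hθtc hutc hq0 hθt0 hσ2 N (Φ N) (μ N) (hKL N) (hEn N)
      ((hIP N).congr (Eventually.of_forall fun z => (hmean0 N z).symm))
      ((hIμ N).congr (Eventually.of_forall fun z => (hmeant N z).symm))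
  have hxT' : Tendsto x atTop (𝓝 (∫ x, ρ 0 x *
      (Real.log (ρ 0 x) + g (ρ 0 x) - 3 / 2 * Real.log (2 * Real.pi * θ 0 x) - 3 / 2))) := by
    refine hxT.congr fun N => integral_congr_ae (Eventually.of_forall fun z => (hmean0 N z).symm)
  have hyT' : Tendsto y atTop (𝓝 (∫ x, ρ t x *
      (Real.log (ρ t x) + g (ρ t x) - 3 / 2 * Real.log (2 * Real.pi * θ t x) - 3 / 2))) := by
    refine hyT.congr fun N => integral_congr_ae (Eventually.of_forall fun z => (hmeant N z).symm)
  have hy : ∀ κ : ℝ, 0 < κ → ∀ᶠ N in atTop, (∫ x, ρ t x *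
      (Real.log (ρ t x) + g (ρ t x) - 3 / 2 * Real.log (2 * Real.pi * θ t x) - 3 / 2)) - κ ≤ y N := fun κ hκ =>
    (hyT'.eventually (lt_mem_nhds (by linarith))).mono fun N h => h.le
  have hk : Tendsto (fun N => K N / ((N : ℝ) + 1)) atTop (𝓝 0) := by
    refine tendsto_zero_of_bookkeeping (k := fun N => K N / ((N : ℝ) + 1)) (x := x)
      (p := fun N => ((N : ℝ) + 1)⁻¹ * Real.log (Z0 N)) (q := fun N => ((N : ℝ) + 1)⁻¹ * Real.log (Zt N)) (y := y)
      hxT' hπ₀ hπt hy (Eventually.of_forall fun N => ?_) (Eventually.of_forall fun N => ?_) hid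
    · exact div_nonneg (hest N).1 (by positivity)
    · have hN : (0 : ℝ) < (N : ℝ) + 1 := by positivity
      rw [div_le_iff₀ hN]
      have h := (hest N).2
      have e : (x N - ((N : ℝ) + 1)⁻¹ * Real.log (Z0 N) - y N + ((N : ℝ) + 1)⁻¹ * Real.log (Zt N)) * ((N : ℝ) + 1) =
          ((N : ℝ) + 1) * (x N - y N) - Real.log (Z0 N) + Real.log (Zt N) := by
        field_simp
        ring
      rw [e]
      exact h
  exact hk

end Summit.AtomisticToContinuum.HydrodynamicLimit.Theorems.SwapGapStaticBookkeeping

end
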